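import Summits.QuantumFields.YangMills.Theorems.BalabanUVNodesN13WilsonPartitionFnAxialTreeUpperBound
import Summits.QuantumFields.YangMills.Theorems.BalabanUVNodesN13GaugeFixingAxialLayers
import Summits.QuantumFields.YangMills.Theorems.BalabanUVNodesN13NormalisationWindowOfCor3AtRecord13SepCoPHV

/-!
# BalabanUVNodes ∕ N13 — THE NORMALISATION CEILING: (B)'s Cor-3 conjunct at a (revised) Stage-13 record datum forces `E(P) ≤ 3(1−1∕n)|T₁^{(0)}|·log linkMass(g₀⁻²) + em(g_K)·n_K − log c_low(K)`
# on every windowed run — the UPPER companion of this seat's lower-side no-go files (p636072 ∕ p640937); with p639903 the witness's normalisation is pinned TWO-SIDEDLY to the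
# Gaussian free energy of the finest lattice

(Track A, DAG node N13 = [B16]; cluster K1 — K1⁹ `StabilityBRunRowsAtRecordR13SepCoPHV` = stmt-QuantumFields-27364, helper; seat `pub-ymgap-dag-n13-w3` g6, INTENT-2; 2026-08-28; count-neutral.)

WHAT THIS FILE SAYS (LOCATED, count-neutral; «what a satisfiable member needs», upper side).  p625602 (`…N13NormalisationWindowOfCor3AtRecord13SepCoPHV`, g4) proved the version-free
window of (B)'s Cor-3 conjunct at `D := datumOfRecord₁₃SepCoPHV θ h v`:  `−em(g_K)n_K + log c_low(K) ≤ log Z_K(g₀⁻²) − E(P) ≤ ep(g_K)n_K` on every γ-windowed run `P = ⟨K, F.m, g₀⟩`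
(`n_K = |T₁^{(K)}| = (2L^m)⁴`, `c_low(K) = smallFieldMass D K g₀`).  The g5 files used ONLY the upper half of the window together with LOWER bounds on `log Z` (no-go for letters of
sub-print slope).  THIS FILE uses the LOWER half of the window together with the NEW axial-tree UPPER bound on `log Z` (CLAIM-1, `…N13WilsonPartitionFnAxialTreeUpperBound`):
* §1 ★★★ `EOfRecord₁₃_le_linkMassCeiling_of_cor3With` — `Cor3With D.C γ em ep`, a γ-windowed run and `0 < c_low(K)` ⟹
  `E(P) ≤ 3·(1 − 1∕n)·|T₁^{(0)}|·log linkMass_{SU(N)}(g₀⁻²) + em(g_K)·n_K − log c_low(K)`, `n = 2L^{m+K}`, `linkMass β = ∫_{SU(N)} e^{−β(1 − Re tr V)}dV ≤ 1` (so in particular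
  `E(P) ≤ em(g_K)·n_K − log c_low(K)`: `…_le_window_of_cor3With`); ★★★ `EOfRecord₁₃_le_linkMassCeiling_of_endStatementBPrinted` — the same from the K1⁹ (B)-slot letter's body with ITS `γ em ep`.
* §2 ★★★ `normalisation_twoSided_of_cor3With` — the TWO-SIDED pin on a windowed run with `0 < g₀ ≤ 1` and `0 < c_low(K)`:
  `−(3 + 1∕n)|T₁^{(0)}|·((d(𝔤)∕2)·log g₀⁻² + C_N) − 128|T₁^{(0)}| − ep(g_K)n_K ≤ E(P) ≤ 3(1 − 1∕n)|T₁^{(0)}|·log linkMass(g₀⁻²) + em(g_K)n_K − log c_low(K)`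
  (lower = p639903's axial-layer Gaussian bound `log_partitionFn_ge_axialLayers_specialUnitary_d4` through the window's upper half; `d(𝔤) = N² − 1`,
  `C_N = N² log(16π+1) + log((2N+1)∕(4π))`).  With a one-plaquette Laplace bound `log linkMass(β) ≤ −(d(𝔤)∕2) log β + c_N` (dag-n13-w1 g6, by name in the sequel) the two sides read
  `E(P) = −(3∕2)·d(𝔤)·|T₁^{(0)}|·log g₀⁻²·(1 + O(1∕n)) + O(|T₁^{(0)}|) + O(n_K·(|em| + |ep|)) − log c_low`: the witness's normalisation constant IS the transversal Gaussian free energy of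
  the finest lattice.  The `c_low` floor (`0 < smallFieldMass`, the integrated small-field lower density at the last step) is DISPLAYED, not discharged — it is what the upper side costs.
HONEST FRAMING: count-neutral bookkeeping + the elementary bounds of the imported files; nothing of Bałaban's asserted or refuted; no skeleton ∕ route text touched; N13 NOT discharged; K1⁹
NEITHER proved NOR refuted; no stub closed; counts UNMOVED (typed 28∕28 · discharged 5∕27 · A 5∕28); one finite 𝕋⁴ at fixed ε; R4 closes the conditional finite-𝕋⁴ rung `BalabanLadder.UV` only —
the Yang–Mills mass gap (Clay) is NOT proved by any of this; nothing continuum ∕ ℝ⁴ ∕ OS.  No `sorry`, `def`, `instance`, `notation`.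

Sources (bookkeeping locators only): [Balaban1988Convergent] (1.15) p.249, Thm 1 p.262, Cor. 3 (2.50) p.264; [Balaban1989LargeFieldII] Thm 1 + (0.1) pp.355–356.
-/

noncomputable section

open MeasureTheory
open scoped BigOperators

namespace Summit.QuantumFields.YangMills.BalabanUVNodes.N13NormalisationCeilingOfCor3AtRecord13SepCoPHV

open Literature.MathematicalPhysics.QuantumFieldTheory.Balaban1983to89
open Literature.MathematicalPhysics.QuantumFieldTheory.Balaban1983to89.T4Continuum
open Literature.MathematicalPhysics.QuantumFieldTheory.Balaban1983to89.Node00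
open Missing T4StabilitySocket
open Summit.QuantumFields.BalabanUV.T4Continuum.NE7b.BarePartitionFnDecay (linkMass linkMass_le_one)
open Summit.QuantumFields.YangMills.BalabanUVNodes.N13WilsonPartitionFnAxialTreeUpperBound (log_partitionFn_le_axialTree_d4 linkMass_pos)
open Summit.QuantumFields.YangMills.BalabanUVNodes.N13GaugeFixingAxialLayers (log_partitionFn_ge_axialLayers_specialUnitary_d4)
open Summit.QuantumFields.YangMills.BalabanUVNodes.N13NormalisationWindowOfCor3AtRecord13SepCoPHV
  (log_partitionFn_sub_E_le_of_cor3With log_partitionFn_sub_E_ge_of_cor3With)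

variable (F : T4Family) (N : ℕ) [NeZero N] (θ : Stage13HParams F N) (h : θ.Provisos₁₃SepCoPH F N) (v : Revision₁₃ F N θ h)

/-! ## §1. The ceiling on `E(P)` from the window's lower half and the axial-tree bound -/

/-- **★★★ THE NORMALISATION CEILING.**  `B16.Cor3With (datumOfRecord₁₃SepCoPHV F N θ h v).C γ em ep`, a γ-windowed run `⟨K, F.m, g₀⟩` and a positive small-field mass `c_low(K)` ⟹
`E(P) ≤ 3·(1 − 1∕n)·|T₁^{(0)}|·log linkMass_{SU(N)}(g₀⁻²) + em(g_K)·n_K − log c_low(K)` (`n = 2L^{m+K}`; the window's lower half `−em·n_K + log c_low ≤ log Z − E` of p625602 and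
the axial-tree bound `log Z ≤ 3(1 − 1∕n)|T₁^{(0)}| log linkMass` of `…N13WilsonPartitionFnAxialTreeUpperBound`).  LOCATED; nothing asserted or refuted.
[cite: Balaban1988Convergent, Thm 1 p.262, (1.15) p.249, Cor. 3 (2.50) p.264 (bookkeeping)] -/
theorem EOfRecord₁₃_le_linkMassCeiling_of_cor3With {γ : ℝ} {em ep : ℝ → ℝ} (hcor : B16.Cor3With (datumOfRecord₁₃SepCoPHV F N θ h v).C γ em ep)
    (K : ℕ) (g₀ : ℝ) (hI : ((datumOfRecord₁₃SepCoPHV F N θ h v).C ⟨K, F.m, g₀⟩).flow.InInterval γ K)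
    (hpos : 0 < smallFieldMass (datumOfRecord₁₃SepCoPHV F N θ h v) K g₀) :
    EOfRecord₁₃ F N θ.toStage13Params ⟨K, F.m, g₀⟩ ≤
      3 * (Fintype.card (Site (F.P K) 0) : ℝ) * (1 - 1 / ((F.P K).sitesPerDir 0 : ℝ)) * Real.log (linkMass (G := SU N) (g₀⁻¹ ^ 2))
        + em (((datumOfRecord₁₃SepCoPHV F N θ h v).C ⟨K, F.m, g₀⟩).flow.g K) * (((datumOfRecord₁₃SepCoPHV F N θ h v).C ⟨K, F.m, g₀⟩).numSites K : ℝ)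
        - Real.log (smallFieldMass (datumOfRecord₁₃SepCoPHV F N θ h v) K g₀) := by
  have hwin := log_partitionFn_sub_E_ge_of_cor3With F N θ h v hcor K g₀ hI hpos
  have hZ := log_partitionFn_le_axialTree_d4 (F.P K) (G := SU N) (T4Family.P_d F K) (sq_nonneg g₀⁻¹)
  linarith

/-- **COROLLARY (no `Z` estimate at all)**: since `linkMass ≤ 1`, `E(P) ≤ em(g_K)·n_K − log c_low(K)` on every windowed run with `c_low(K) > 0` — the witness's normalisation
constant is bounded ABOVE by the window slack alone (`Z ≤ 1`). [cite: Balaban1988Convergent, Thm 1 p.262, Cor. 3 (2.50) p.264 (bookkeeping)] -/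
theorem EOfRecord₁₃_le_window_of_cor3With {γ : ℝ} {em ep : ℝ → ℝ} (hcor : B16.Cor3With (datumOfRecord₁₃SepCoPHV F N θ h v).C γ em ep)
    (K : ℕ) (g₀ : ℝ) (hI : ((datumOfRecord₁₃SepCoPHV F N θ h v).C ⟨K, F.m, g₀⟩).flow.InInterval γ K)
    (hpos : 0 < smallFieldMass (datumOfRecord₁₃SepCoPHV F N θ h v) K g₀) :
    EOfRecord₁₃ F N θ.toStage13Params ⟨K, F.m, g₀⟩ ≤
      em (((datumOfRecord₁₃SepCoPHV F N θ h v).C ⟨K, F.m, g₀⟩).flow.g K) * (((datumOfRecord₁₃SepCoPHV F N θ h v).C ⟨K, F.m, g₀⟩).numSites K : ℝ)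
        - Real.log (smallFieldMass (datumOfRecord₁₃SepCoPHV F N θ h v) K g₀) := by
  have h1 := EOfRecord₁₃_le_linkMassCeiling_of_cor3With F N θ h v hcor K g₀ hI hpos
  have hlog : Real.log (linkMass (G := SU N) (g₀⁻¹ ^ 2)) ≤ 0 :=
    Real.log_nonpos (linkMass_pos (G := SU N) _).le (linkMass_le_one (G := SU N) (sq_nonneg _))
  have hcoef : 0 ≤ 3 * (Fintype.card (Site (F.P K) 0) : ℝ) * (1 - 1 / ((F.P K).sitesPerDir 0 : ℝ)) := by
    have hn : (1 : ℝ) ≤ ((F.P K).sitesPerDir 0 : ℝ) := by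
      exact_mod_cast Nat.pos_of_ne_zero ((F.P K).sitesPerDir_ne_zero 0)
    have : 0 ≤ 1 - 1 / ((F.P K).sitesPerDir 0 : ℝ) := by
      rw [sub_nonneg, div_le_one (lt_of_lt_of_le one_pos hn)]; exact hn
    positivity
  have hprod := mul_nonpos_of_nonneg_of_nonpos hcoef hlog
  linarith

/-- **★★★ THE CEILING FROM THE K1⁹ (B)-SLOT LETTER's BODY**: `B16.EndStatementBPrinted (datumOfRecord₁₃SepCoPHV F N θ h v).C` ⟹ `∃ γ > 0, ∃ em ep`, on EVERY γ-windowed run with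
`c_low(K) > 0`:  `E(P) ≤ 3(1 − 1∕n)|T₁^{(0)}|·log linkMass(g₀⁻²) + em(g_K)·n_K − log c_low(K)`. [cite: Balaban1989LargeFieldII, Thm 1 + (0.1) pp.355–356; Balaban1988Convergent, Cor. 3 (2.50) p.264] -/
theorem EOfRecord₁₃_le_linkMassCeiling_of_endStatementBPrinted (hB : B16.EndStatementBPrinted (datumOfRecord₁₃SepCoPHV F N θ h v).C) :
    ∃ γ : ℝ, 0 < γ ∧ ∃ em ep : ℝ → ℝ, B16.Cor3With (datumOfRecord₁₃SepCoPHV F N θ h v).C γ em ep ∧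
      ∀ (K : ℕ) (g₀ : ℝ), ((datumOfRecord₁₃SepCoPHV F N θ h v).C ⟨K, F.m, g₀⟩).flow.InInterval γ K →
        0 < smallFieldMass (datumOfRecord₁₃SepCoPHV F N θ h v) K g₀ →
          EOfRecord₁₃ F N θ.toStage13Params ⟨K, F.m, g₀⟩ ≤
            3 * (Fintype.card (Site (F.P K) 0) : ℝ) * (1 - 1 / ((F.P K).sitesPerDir 0 : ℝ)) * Real.log (linkMass (G := SU N) (g₀⁻¹ ^ 2))
              + em (((datumOfRecord₁₃SepCoPHV F N θ h v).C ⟨K, F.m, g₀⟩).flow.g K) * (((datumOfRecord₁₃SepCoPHV F N θ h v).C ⟨K, F.m, g₀⟩).numSites K : ℝ)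
              - Real.log (smallFieldMass (datumOfRecord₁₃SepCoPHV F N θ h v) K g₀) := by
  obtain ⟨-, γ, hγ, em, ep, hcor⟩ := hB
  exact ⟨γ, hγ, em, ep, hcor, fun K g₀ hI hpos => EOfRecord₁₃_le_linkMassCeiling_of_cor3With F N θ h v hcor K g₀ hI hpos⟩

/-! ## §2. The two-sided pin: the witness's normalisation is the Gaussian free energy of the finest lattice -/

/-- **★★★ THE TWO-SIDED NORMALISATION WINDOW IN GAUSSIAN CURRENCY.**  `Cor3With D.C γ em ep` at `D := datumOfRecord₁₃SepCoPHV F N θ h v`, a γ-windowed run `⟨K, F.m, g₀⟩` with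
`0 < g₀ ≤ 1`, and `0 < c_low(K)` ⟹
`−(3 + 1∕n)·|T₁^{(0)}|·(((N²−1)∕2)·log g₀⁻² + C_N) − 128·|T₁^{(0)}| − ep(g_K)·n_K ≤ E(P) ≤ 3(1 − 1∕n)·|T₁^{(0)}|·log linkMass(g₀⁻²) + em(g_K)·n_K − log c_low(K)`
(`C_N = N² log(16π+1) + log((2N+1)∕(4π))`; lower: p639903 through p625602's upper half; upper: §1).  LOCATED; nothing asserted or refuted.
[cite: Balaban1988Convergent, Thm 1 p.262, (1.15) p.249, Cor. 3 (2.50) p.264; Balaban1989LargeFieldII, (0.1) pp.355–356 (bookkeeping)] -/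
theorem normalisation_twoSided_of_cor3With {γ : ℝ} {em ep : ℝ → ℝ} (hcor : B16.Cor3With (datumOfRecord₁₃SepCoPHV F N θ h v).C γ em ep)
    (K : ℕ) {g₀ : ℝ} (hg₀ : 0 < g₀) (hg₁ : g₀ ≤ 1) (hI : ((datumOfRecord₁₃SepCoPHV F N θ h v).C ⟨K, F.m, g₀⟩).flow.InInterval γ K)
    (hpos : 0 < smallFieldMass (datumOfRecord₁₃SepCoPHV F N θ h v) K g₀) :
    -((3 + ((F.P K).sitesPerDir 0 : ℝ)⁻¹) * (Fintype.card (Site (F.P K) 0) : ℝ)) *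
          ((((N * N : ℕ) : ℝ) - 1) / 2 * Real.log (g₀⁻¹ ^ 2) + (((N * N : ℕ) : ℝ) * Real.log (16 * Real.pi + 1) + Real.log ((2 * N + 1) / (4 * Real.pi))))
        - 128 * (Fintype.card (Site (F.P K) 0) : ℝ)
        - ep (((datumOfRecord₁₃SepCoPHV F N θ h v).C ⟨K, F.m, g₀⟩).flow.g K) * (((datumOfRecord₁₃SepCoPHV F N θ h v).C ⟨K, F.m, g₀⟩).numSites K : ℝ)
        ≤ EOfRecord₁₃ F N θ.toStage13Params ⟨K, F.m, g₀⟩ ∧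
      EOfRecord₁₃ F N θ.toStage13Params ⟨K, F.m, g₀⟩ ≤
        3 * (Fintype.card (Site (F.P K) 0) : ℝ) * (1 - 1 / ((F.P K).sitesPerDir 0 : ℝ)) * Real.log (linkMass (G := SU N) (g₀⁻¹ ^ 2))
          + em (((datumOfRecord₁₃SepCoPHV F N θ h v).C ⟨K, F.m, g₀⟩).flow.g K) * (((datumOfRecord₁₃SepCoPHV F N θ h v).C ⟨K, F.m, g₀⟩).numSites K : ℝ)
          - Real.log (smallFieldMass (datumOfRecord₁₃SepCoPHV F N θ h v) K g₀) := by
  refine ⟨?_, EOfRecord₁₃_le_linkMassCeiling_of_cor3With F N θ h v hcor K g₀ hI hpos⟩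
  have hβ : 1 ≤ g₀⁻¹ ^ 2 := by
    have h1 : 1 ≤ g₀⁻¹ := (one_le_inv₀ hg₀).2 hg₁
    nlinarith
  have hup := log_partitionFn_sub_E_le_of_cor3With F N θ h v hcor K g₀ hI
  have hZ := log_partitionFn_ge_axialLayers_specialUnitary_d4 N (F.P K) (T4Family.P_d F K) hβ
  linarith

end Summit.QuantumFields.YangMills.BalabanUVNodes.N13NormalisationCeilingOfCor3AtRecord13SepCoPHV

end
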